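import Summits.RiemannHypothesis.RiemannHypothesis.Theorems.Splittings.LiExtremalLayer
import HarnessLib

/-!
# Splittings — Li bridge lens, the EXTREMAL-LAYER LAW for `λ_n`, part 3/3: SIGN PATTERNS — bounded-gap descents AND ascents under `¬RH`,
# monotonicity / positivity on a THICK or DENSITY-ONE index set ⟹ RH (the card's T-Li2 and V6 in KERNEL), late RUNS of 201 negative `λ_n`
# (SPLIT-li-bridge gen 5 §§5–6; zero-definition raw form)

Cell rh-split, seat rh-split-li-bridge g5 (brief sha16 f79c5f09d8bcb036), card `run/shared/lean/pub/rh-split/cards/SPLIT-li-bridge.md`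
§12 (gen-5 addendum; lead rh-split-lead g2 ROUTED 2026-08-27T04:37:55Z «carve plan §12.7 A/B … zero-def (12 bookkeeping defs → spell out
or cite); bytes to referee g3 first»); source `HOME/rh-split-li-bridge/SketchG5.lean` sha16 11e7614000dc855f (856 l, ns `RhSplit.LiBridgeG5`).
Filed by rh-split-typer-1 g4 in three parts (400-line rule): `LiExtremalLayerWindow` (§§1–2), `LiExtremalLayer` (§§3–4 + the syndetic
corollaries), `LiSignPatterns` (§§5–6).  Tree inputs (cited, not re-derived): `Voros2006_eqDA_holds`, `Voros2006_thm_onlyif_holds`,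
`li_criterion_holds`, `riemannHypothesis_iff_liPosOn_thick` + `IsThick` / `HasGapsLe` / `RecurrentFor` (Theorems/Splittings/LiIndexSets*),
`liZeroBox_finite`, `FordL33.order_pos/coe_ne_zero`, `LiIndexSets.one_lt_norm_inv_one_sub_inv_iff`, `LiIndexSets.re_eq_half_of_abs_im_le`,
`riemannHypothesisUpTo_1000`.
This part is ZERO-DEF: the scratch's SketchG2 objects `liIncr n := λ_{n+1} − λ_n`, `exceptCount E N := #{n < N : n ∈ E}` (classical
decidability, as in the scratch's `open Classical in def`), `DensityZero E := ∀ ε > 0, ∀ᶠ N, exceptCount E N ≤ ε N`, `AlmostAllLiMonotone`,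
`AlmostAllLiMonotoneImpliesRh` are SPELLED OUT at every site (card §12.7: «zero new defs if T-Li2 is filed in its def-free form … with
`exceptCount` spelled as `((range N).filter (· ∈ E)).card`»).
* §5b `liIncr_two_signs_of_not_rh` (bounded-gap descents AND ascents), `rh_of_liIncr_nonneg_on_thick` / `rh_of_liIncr_nonpos_on_thick`,
  `rh_of_li_monotoneOn_thick` / `rh_of_li_antitoneOn_thick`, `isThick_of_densityZero`, **T-Li2 in kernel** `almostAllLiMonotone_implies_rh`
  (∃-form) = `rh_of_liIncr_nonneg_off_densityZero` (def-free form), `rh_iff_liNeg_not_syndetic`, **V6** `rh_of_liPos_off_densityZero`,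
  `rh_iff_liPos_off_densityZero` (RH-EQUIVALENT CRITERION);
* §6 (COROLLARY OF THE TREE — li-neg's `LiIndexSetsSyndetic` + `riemannHypothesisUpTo_1000`): `liNeg_runs_of_not_rh`, `liNeg_runs_201_of_not_rh`,
  `rh_iff_no_liNeg_run_201`, `li_sign_portrait_of_not_rh`, `hasGapsLe_liPos`, `not_rh_iff_hasGapsLe_liNeg`.
Referee labels per card §12 ((6)(7) RH-PLUS SUFFICIENT CONDITIONS, T-Li2 PAPER → KERNEL; (8) RH-EQUIVALENT; (9) tree corollary, FIN(1000) load-bearing).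
HONEST LABEL: «SPLITTING SEARCH over kernel-typed RH-EQUIVALENCES; a splitting A ∧ B ⟹ RH is CONDITIONAL bookkeeping
unless A and B are both proved; nothing here bears on the truth of RH.»  Every theorem below is RH-FREE (an implication /
dichotomy proved outright) or an RH-EQUIVALENCE.
-/

set_option linter.dupNamespace false

noncomputable section

open Complex Filter Topology Finset Asymptotics
open scoped Real ComplexConjugate

namespace Summit.RiemannHypothesis.RiemannHypothesis.Theorems.Splittings.LiExtremalLayer

open Literature.NumberTheory.LFunctions
open Summit.RiemannHypothesis.RiemannHypothesis.Theorems.Splittings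
open Summit.RiemannHypothesis.RiemannHypothesis.Theorems.Splittings.LiIndexSets

/-! ## §5b Bounded-gap DESCENTS and ASCENTS of `λ_n` under `¬RH`; monotonicity on a thick set ⟹ RH -/

/-- Chains of non-negative increments. -/
theorem le_of_forall_incr {f : ℕ → ℝ} (p : ℕ) :
    ∀ k : ℕ, (∀ n, p ≤ n → n < p + k → f n ≤ f (n + 1)) → f p ≤ f (p + k)
  | 0, _ => by simp
  | k + 1, h => by
    have ih := le_of_forall_incr p k fun n h1 h2 ↦ h n h1 (by omega)
    have := h (p + k) (by omega) (by omega)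
    rw [← add_assoc]
    exact ih.trans this

/-- **`¬RH` ⟹ bounded-gap DESCENTS and ASCENTS**: every window `[a, a+L)`, `a ≥ n₁`, contains an `n` with
`λ_{n+1} < λ_n` and an `n'` with `λ_{n'} < λ_{n'+1}`. -/
theorem liIncr_two_signs_of_not_rh (hRH : ¬ _root_.RiemannHypothesis) :
    ∃ L n₁ : ℕ, ∀ a : ℕ, n₁ ≤ a →
      (∃ n ∈ Ico a (a + L), keiperLiCoeff (n + 1) < keiperLiCoeff n) ∧
      (∃ n ∈ Ico a (a + L), keiperLiCoeff n < keiperLiCoeff (n + 1)) := by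
  obtain ⟨r₀, hr₀0, -, -, -, c, hc, -, L, n₁, -, hwin⟩ := li_two_signs_of_not_rh hRH
  have hpos : ∀ n : ℕ, 0 < c * r₀⁻¹ ^ n := fun n ↦ mul_pos hc (pow_pos (inv_pos.2 hr₀0) n)
  refine ⟨L + L, n₁, fun a ha ↦ ⟨?_, ?_⟩⟩
  · obtain ⟨p, hp, hlp⟩ := (hwin a ha).1
    obtain ⟨q, hq, hlq⟩ := (hwin (a + L) (by omega)).2
    rw [Finset.mem_Ico] at hp hq
    obtain ⟨k, rfl⟩ := Nat.exists_eq_add_of_le (show p ≤ q by omega)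
    by_contra hno
    push Not at hno
    have hmono := le_of_forall_incr (f := keiperLiCoeff) p k fun n h1 h2 ↦
      hno n (Finset.mem_Ico.2 ⟨by omega, by omega⟩)
    linarith [hpos p, hpos (p + k)]
  · obtain ⟨q, hq, hlq⟩ := (hwin a ha).2
    obtain ⟨p, hp, hlp⟩ := (hwin (a + L) (by omega)).1
    rw [Finset.mem_Ico] at hp hq
    obtain ⟨k, rfl⟩ := Nat.exists_eq_add_of_le (show q ≤ p by omega)
    by_contra hno
    push Not at hno
    have hanti := le_of_forall_incr (f := fun n ↦ -keiperLiCoeff n) q k fun n h1 h2 ↦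
      neg_le_neg (hno n (Finset.mem_Ico.2 ⟨by omega, by omega⟩))
    simp only [neg_le_neg_iff] at hanti
    linarith [hpos q, hpos (q + k)]

/-- **Non-decreasing on a THICK index set ⟹ RH**: if `λ_n ≤ λ_{n+1}` for all `n` in a set containing
arbitrarily long runs of consecutive integers, then RH. -/
theorem rh_of_liIncr_nonneg_on_thick {S : Set ℕ} (hS : IsThick S)
    (h : ∀ n ∈ S, keiperLiCoeff n ≤ keiperLiCoeff (n + 1)) : _root_.RiemannHypothesis := by
  by_contra hRH
  obtain ⟨L, n₁, hL⟩ := liIncr_two_signs_of_not_rh hRH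
  obtain ⟨a, ha⟩ := hS (L + n₁)
  obtain ⟨n, hn, hlt⟩ := (hL (a + n₁) (by omega)).1
  rw [Finset.mem_Ico] at hn
  obtain ⟨t, rfl⟩ := Nat.exists_eq_add_of_le (show a ≤ n by omega)
  linarith [h (a + t) (ha t (by omega))]

/-- **Non-increasing on a thick index set ⟹ RH** (the mirror statement). -/
theorem rh_of_liIncr_nonpos_on_thick {S : Set ℕ} (hS : IsThick S)
    (h : ∀ n ∈ S, keiperLiCoeff (n + 1) ≤ keiperLiCoeff n) : _root_.RiemannHypothesis := by
  by_contra hRH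
  obtain ⟨L, n₁, hL⟩ := liIncr_two_signs_of_not_rh hRH
  obtain ⟨a, ha⟩ := hS (L + n₁)
  obtain ⟨n, hn, hlt⟩ := (hL (a + n₁) (by omega)).2
  rw [Finset.mem_Ico] at hn
  obtain ⟨t, rfl⟩ := Nat.exists_eq_add_of_le (show a ≤ n by omega)
  linarith [h (a + t) (ha t (by omega))]

/-- Runs of `S` give runs of `{n ∈ S, n+1 ∈ S}`. -/
theorem isThick_inter_succ {S : Set ℕ} (hS : IsThick S) : IsThick {n | n ∈ S ∧ n + 1 ∈ S} := by
  intro L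
  obtain ⟨a, ha⟩ := hS (L + 1)
  exact ⟨a, fun t ht ↦ ⟨ha t (by omega), by rw [add_assoc]; exact ha (t + 1) (by omega)⟩⟩

/-- **`λ` monotone (either way) on a thick set ⟹ RH.** -/
theorem rh_of_li_monotoneOn_thick {S : Set ℕ} (hS : IsThick S) (h : MonotoneOn keiperLiCoeff S) :
    _root_.RiemannHypothesis :=
  rh_of_liIncr_nonneg_on_thick (isThick_inter_succ hS) fun _ hn ↦ h hn.1 hn.2 (Nat.le_succ _)

/-- **`λ` antitone on a thick set ⟹ RH** (mirror of `rh_of_li_monotoneOn_thick`). -/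
theorem rh_of_li_antitoneOn_thick {S : Set ℕ} (hS : IsThick S) (h : AntitoneOn keiperLiCoeff S) :
    _root_.RiemannHypothesis :=
  rh_of_liIncr_nonpos_on_thick (isThick_inter_succ hS) fun _ hn ↦ h hn.1 hn.2 (Nat.le_succ _)

/-! ### Density-one monotonicity (the card's NEW OBJECT of §8; the scratch's SketchG2 defs `liIncr`, `exceptCount`, `DensityZero`,
`AlmostAllLiMonotone` SPELLED OUT) ⟹ RH -/

open Classical in
/-- The complement of a density-zero set (spelled out: `#{n < N : n ∈ E} ≤ εN` eventually, every `ε > 0`) is THICK (a set meeting every block of length `T+1` has lower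
density `≥ 1/(T+1)`). -/
theorem isThick_of_densityZero {E : Set ℕ}
    (hE : ∀ ε : ℝ, 0 < ε → ∀ᶠ N : ℕ in atTop, (((range N).filter (fun n => n ∈ E)).card : ℝ) ≤ ε * N) :
    IsThick {n | 1 ≤ n ∧ n ∉ E} := by
  classical
  intro T
  by_contra hno
  push Not at hno
  have hex : ∀ a : ℕ, ∃ s : ℕ, s ≤ T ∧ (1 ≤ a → a + s ∈ E) := by
    intro a
    obtain ⟨s, hs, hnot⟩ := hno a
    exact ⟨s, hs, fun ha ↦ by by_contra hmem; exact hnot ⟨by omega, hmem⟩⟩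
  choose t ht htE using hex
  set b : ℕ → ℕ := fun k ↦ 1 + k * (T + 1) with hb
  have hbsucc : ∀ k, b (k + 1) = b k + (T + 1) := fun k ↦ by simp only [hb]; ring
  have hbmono : ∀ k K, k ≤ K → b k ≤ b K := fun k K h ↦ by
    simp only [hb]; exact Nat.add_le_add_left (Nat.mul_le_mul_right _ h) _
  set f : ℕ → ℕ := fun k ↦ b k + t (b k) with hf
  have hfE : ∀ k, f k ∈ E := fun k ↦ htE (b k) (by simp only [hb]; omega)
  have hf_lt : ∀ k, f k < b (k + 1) := fun k ↦ by
    rw [hbsucc]; have := ht (b k); simp only [hf]; omega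
  have hfmono : StrictMono f := strictMono_nat_of_lt_succ fun k ↦
    (hf_lt k).trans_le (by simp only [hf]; omega)
  have hε : (0 : ℝ) < 1 / (2 * ((T : ℝ) + 1)) := by positivity
  obtain ⟨N₀, hN₀⟩ := eventually_atTop.1 (hE _ hε)
  set K := N₀ + 2 with hK
  have hKle : N₀ ≤ b K := by
    have : K ≤ K * (T + 1) := Nat.le_mul_of_pos_right K (by omega)
    simp only [hb]; omega
  have hcount : K ≤ ((range (b K)).filter (fun n => n ∈ E)).card := by
    calc K = ((Finset.range K).image f).card := by
          rw [Finset.card_image_of_injective _ hfmono.injective, Finset.card_range]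
      _ ≤ _ := Finset.card_le_card fun x hx ↦ by
          obtain ⟨k, hk, rfl⟩ := Finset.mem_image.1 hx
          refine Finset.mem_filter.2 ⟨Finset.mem_range.2 ?_, hfE k⟩
          exact (hf_lt k).trans_le (hbmono _ _ (Finset.mem_range.1 hk))
  have hbound := hN₀ (b K) hKle
  have h1 : (K : ℝ) ≤ 1 / (2 * ((T : ℝ) + 1)) * ((b K : ℕ) : ℝ) :=
    le_trans (by exact_mod_cast hcount) hbound
  have h2 : ((b K : ℕ) : ℝ) = 1 + (K : ℝ) * ((T : ℝ) + 1) := by simp only [hb]; push_cast; ring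
  rw [h2, div_mul_eq_mul_div, one_mul, le_div_iff₀ (by positivity)] at h1
  have hK2 : (2 : ℝ) ≤ K := by
    have : 2 ≤ K := by omega
    exact_mod_cast this
  have hT0 : (0 : ℝ) ≤ T := Nat.cast_nonneg T
  nlinarith [mul_le_mul_of_nonneg_right hK2 (by positivity : (0 : ℝ) ≤ (T : ℝ) + 1)]

open Classical in
/-- **T-Li2 in KERNEL: density-one monotonicity of `λ_n` implies RH** (the scratch's `AlmostAllLiMonotoneImpliesRh :=
AlmostAllLiMonotone → Summit.RiemannHypothesis` — the g2 TARGET `D⇐`, typed there with a paper proof only — SPELLED OUT: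
`λ_{n+1} − λ_n ≥ 0` for all `n ≥ 1` outside a density-zero index set ⟹ RH). -/
theorem almostAllLiMonotone_implies_rh :
    (∃ E : Set ℕ, (∀ ε : ℝ, 0 < ε → ∀ᶠ N : ℕ in atTop, (((range N).filter (fun n => n ∈ E)).card : ℝ) ≤ ε * N) ∧
      ∀ n : ℕ, 1 ≤ n → n ∉ E → 0 ≤ keiperLiCoeff (n + 1) - keiperLiCoeff n) → Summit.RiemannHypothesis := by
  rintro ⟨E, hE, hmono⟩
  exact rh_of_liIncr_nonneg_on_thick (isThick_of_densityZero hE) fun n hn ↦ by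
    have := hmono n hn.1 hn.2
    linarith

open Classical in
/-- **T-Li2, def-free reading**: `λ_n ≤ λ_{n+1}` for all `n ≥ 1` outside an index set `E` of natural density zero ⟹ RH. -/
theorem rh_of_liIncr_nonneg_off_densityZero (E : Set ℕ)
    (hE : ∀ ε : ℝ, 0 < ε → ∀ᶠ N : ℕ in atTop, (((range N).filter (fun n => n ∈ E)).card : ℝ) ≤ ε * N)
    (h : ∀ n : ℕ, 1 ≤ n → n ∉ E → keiperLiCoeff n ≤ keiperLiCoeff (n + 1)) : _root_.RiemannHypothesis :=
  almostAllLiMonotone_implies_rh ⟨E, hE, fun n hn hnE ↦ by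
    have := h n hn hnE; linarith⟩

/-- RH ⟺ the negative Li indices do NOT form a syndetic set (criterion form of the dichotomy). -/
theorem rh_iff_liNeg_not_syndetic :
    _root_.RiemannHypothesis ↔ ¬ ∃ L : ℕ, ∀ N : ℕ, ∃ n ∈ Ico N (N + L), keiperLiCoeff n < 0 := by
  rw [← not_rh_iff_liNeg_syndetic, not_not]

/-! ### Density-one POSITIVITY (the card's V6) — RH-equivalent, in kernel -/

open Classical in
/-- **V6 in KERNEL: `λ_n ≥ 0` off a density-zero set ⟹ RH** (the complement is thick; tree
`riemannHypothesis_iff_liPosOn_thick`; `DensityZero` spelled out). -/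
theorem rh_of_liPos_off_densityZero (E : Set ℕ)
    (hE : ∀ ε : ℝ, 0 < ε → ∀ᶠ N : ℕ in atTop, (((range N).filter (fun n => n ∈ E)).card : ℝ) ≤ ε * N)
    (h : ∀ n : ℕ, 1 ≤ n → n ∉ E → 0 ≤ keiperLiCoeff n) : _root_.RiemannHypothesis :=
  (riemannHypothesis_iff_liPosOn_thick (isThick_of_densityZero hE)).2 fun n hn _ ↦ h n hn.1 hn.2

open Classical in
/-- **RH ⟺ Li positivity off SOME density-zero set** (RH-EQUIVALENT CRITERION; `⇒` with `E = ∅`). -/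
theorem rh_iff_liPos_off_densityZero :
    _root_.RiemannHypothesis ↔ ∃ E : Set ℕ, (∀ ε : ℝ, 0 < ε → ∀ᶠ N : ℕ in atTop, (((range N).filter (fun n => n ∈ E)).card : ℝ) ≤ ε * N) ∧
      ∀ n : ℕ, 1 ≤ n → n ∉ E → 0 ≤ keiperLiCoeff n := by
  constructor
  · intro hRH
    refine ⟨∅, fun ε hε ↦ Eventually.of_forall fun N ↦ ?_, fun n hn _ ↦ (li_criterion_holds.1 hRH) n hn⟩
    have h0 : (0 : ℝ) ≤ ε * N := by positivity
    simpa using h0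
  · rintro ⟨E, hE, h⟩
    exact rh_of_liPos_off_densityZero E hE h

/-! ## §6 The complementary half of the portrait (a COROLLARY OF THE TREE, li-neg's `LiIndexSetsSyndetic`):
under `¬RH` the negativity set contains arbitrarily late RUNS of `g+1` consecutive indices whenever the zeros are
verified to height `H ≥ 5g` — with the tree's `riemannHypothesisUpTo_1000` (kernel `decide`, std axioms): runs of 201.
Together with parts 2–3: `¬RH` ⟹ `{λ_n < 0}` is SYNDETIC and has arbitrarily late runs of length 201, `{λ_n > 0}` is
syndetic; RH ⟹ `{λ_n < 0} ⊆ {0}`. -/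

section Runs

open Literature.NumberTheory.DiophantineGeometry (RiemannHypothesisUpTo)

/-- `RecurrentFor` only sees tails. -/
theorem recurrentFor_of_tail {ι : Type*} {ρ : ι → ℂ} {S T : Set ℕ} (N₀ : ℕ) (hS : RecurrentFor ρ S)
    (hST : ∀ n ∈ S, N₀ ≤ n → n ∈ T) : RecurrentFor ρ T := by
  intro B hB N
  obtain ⟨n, hnS, hNn, hre⟩ := hS B hB (max N N₀)
  exact ⟨n, hST n hnS ((le_max_right _ _).trans hNn), (le_max_left _ _).trans hNn, hre⟩

/-- **`¬RH` ⟹ arbitrarily late runs of `g + 1` consecutive negative Li coefficients**, given the zeros to height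
`H ≥ 5g` (tree: slow phases of the reflected off-line zeros recur in every set with gaps `≤ g`). -/
theorem liNeg_runs_of_not_rh (hRH : ¬ _root_.RiemannHypothesis) {H : ℝ} (hA : RiemannHypothesisUpTo H)
    (hH : 0 < H) {g : ℕ} (hg : 5 * (g : ℝ) ≤ H) (N : ℕ) :
    ∃ m : ℕ, N ≤ m ∧ ∀ n : ℕ, m ≤ n → n ≤ m + g → keiperLiCoeff n < 0 := by
  by_contra hno
  push Not at hno
  set S : Set ℕ := {n | n < N + g + 1} ∪ {n | N ≤ n ∧ 0 ≤ keiperLiCoeff n} with hSdef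
  have hS : HasGapsLe S g := by
    intro m
    by_cases hm : m < N + 1
    · exact ⟨m, Or.inl (by simp only [Set.mem_setOf_eq]; omega), le_rfl, by omega⟩
    · obtain ⟨n, hmn, hnm, hn⟩ := hno m (by omega)
      exact ⟨n, Or.inr ⟨by omega, hn⟩, hmn, hnm⟩
  have hrec := recurrentFor_zetaZeros_of_gaps hH (fun _ hρ hle ↦ re_eq_half_of_abs_im_le hA hρ hle) hS hg
  have hrec' := recurrentFor_of_tail (T := {n | N + g + 1 ≤ n ∧ 0 ≤ keiperLiCoeff n}) (N + g + 1) hrec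
    (by
      rintro n (hn | ⟨-, hn⟩) hge
      · simp only [Set.mem_setOf_eq] at hn; omega
      · exact ⟨hge, hn⟩)
  exact hRH (riemannHypothesis_of_liPosOn_of_recurrentFor hrec' fun n hn _ ↦ hn.2)

/-- With the tree's `riemannHypothesisUpTo_1000`: **`¬RH` ⟹ arbitrarily late runs of 201 consecutive `λ_n < 0`.** -/
theorem liNeg_runs_201_of_not_rh (hRH : ¬ _root_.RiemannHypothesis) (N : ℕ) :
    ∃ m : ℕ, N ≤ m ∧ ∀ n : ℕ, m ≤ n → n ≤ m + 200 → keiperLiCoeff n < 0 :=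
  liNeg_runs_of_not_rh hRH riemannHypothesisUpTo_1000 (by norm_num) (by norm_num) N

/-- **RH ⟺ no late run of 201 consecutive negative Li coefficients** (criterion form; `⇒` by Li). -/
theorem rh_iff_no_liNeg_run_201 :
    _root_.RiemannHypothesis ↔ ∃ N : ℕ, ∀ m : ℕ, N ≤ m → ∃ n : ℕ, m ≤ n ∧ n ≤ m + 200 ∧ 0 ≤ keiperLiCoeff n := by
  constructor
  · intro hRH
    exact ⟨1, fun m hm ↦ ⟨m, le_rfl, by omega, (li_criterion_holds.1 hRH) m hm⟩⟩
  · rintro ⟨N, hN⟩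
    by_contra hRH
    obtain ⟨m, hNm, hrun⟩ := liNeg_runs_201_of_not_rh hRH N
    obtain ⟨n, hmn, hnm, hn⟩ := hN m hNm
    linarith [hrun n hmn hnm]

/-- **The two halves side by side** (`¬RH`): the negativity set is syndetic AND has arbitrarily late runs of
length 201; the positivity set is syndetic. -/
theorem li_sign_portrait_of_not_rh (hRH : ¬ _root_.RiemannHypothesis) :
    (∃ L : ℕ, ∀ N : ℕ, ∃ n ∈ Ico N (N + L), keiperLiCoeff n < 0) ∧
    (∃ L : ℕ, ∀ N : ℕ, ∃ n ∈ Ico N (N + L), 0 < keiperLiCoeff n) ∧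
    (∀ N : ℕ, ∃ m : ℕ, N ≤ m ∧ ∀ n : ℕ, m ≤ n → n ≤ m + 200 → keiperLiCoeff n < 0) :=
  ⟨not_rh_iff_liNeg_syndetic.1 hRH, liPos_syndetic, liNeg_runs_201_of_not_rh hRH⟩

/-- Tree vocabulary: the positivity set has bounded gaps (`HasGapsLe`), unconditionally. -/
theorem hasGapsLe_liPos : ∃ g : ℕ, HasGapsLe {n | 0 < keiperLiCoeff n} g := by
  obtain ⟨L, hL⟩ := liPos_syndetic
  refine ⟨L, fun m ↦ ?_⟩
  obtain ⟨n, hn, hpos⟩ := hL m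
  rw [Finset.mem_Ico] at hn
  exact ⟨n, hpos, hn.1, by omega⟩

/-- Tree vocabulary: `¬RH ⟺` the negativity set has bounded gaps. -/
theorem not_rh_iff_hasGapsLe_liNeg : ¬ _root_.RiemannHypothesis ↔ ∃ g : ℕ, HasGapsLe {n | keiperLiCoeff n < 0} g := by
  rw [not_rh_iff_liNeg_syndetic]
  constructor
  · rintro ⟨L, hL⟩
    refine ⟨L, fun m ↦ ?_⟩
    obtain ⟨n, hn, hneg⟩ := hL m
    rw [Finset.mem_Ico] at hn
    exact ⟨n, hneg, hn.1, by omega⟩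
  · rintro ⟨g, hg⟩
    refine ⟨g + 1, fun N ↦ ?_⟩
    obtain ⟨n, hneg, hNn, hng⟩ := hg N
    exact ⟨n, Finset.mem_Ico.2 ⟨hNn, by omega⟩, hneg⟩

end Runs

end Summit.RiemannHypothesis.RiemannHypothesis.Theorems.Splittings.LiExtremalLayer

end
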